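import Summits.HodgeConjecture.HodgeConjecture.Theorems.F0P3cStCharTSUpTrClaimP            -- ★ (P3) p852453 (this lineage, g22): `finsum_upSummand_eq_weightedSum` — the engine
import Literature.NumberTheory.Rogawski1990.FinExplicitTransferFactorStableInvariance         -- ★ p839998: `finCharpolyTwo_eq_of_isLocalStablyConjH` (`χ_g` is a stable class function on `H_v`)
import Literature.NumberTheory.Rogawski1990.FinWeylDiscriminantFactorisation                 -- ★ (N1) p852353: the `normAbs` currency of the closed Weyl radicals `D_G`, `D_H`
import HarnessLib

/-!
# F0 · P3c · crux H413 — ROAD «UP-TR», (A1′) FILE F carve (F3) «hP3 OF (P3)»: the `hP3` binder of ★ (A1′)-E `upTransferLB_concrete_of_inputs` DISCHARGED —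
# CLAIM-P at the CLOSED Weyl radical `D_H = (∏_w |disc χ_g|_w · (∏_w |det g|_w)⁻¹)^{1∕4}` of ★ (P1) `hconcrete`, with (P3)'s weights `[N_H(T):T]⁻¹ · (m T)⁻¹`
# [Rogawski1990 §12.5 pp. 182–183, Lemma 12.5.1; §4.9 p. 55]

Cell `pub/hodgecm-mathlib`, crux H413 = `stmt-HodgeConjecture-24833` (lane `--supports … --as helper`, count-neutral), route HCCMUnconditional; seat F0P3a-p06 (g23), heir of the
★ (P3) author (g22).  ROAD «UP-TR» (holder ∕ dealer F0P3-p02 (g23)); (A1′) pen LH10-p01 (g8)'s F PLAN + CARVE OFFER 2026-09-02T19:44:06Z, piece (F3); co-hand LH10-p02 (g10)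
stood down 19:45:13Z.  THEOREMS ONLY (no definition ∕ instance ∕ notation ∕ named fact ∕ `sorry`); ★-only imports; axioms TRIO.

WHAT.  ★ (A1′)-E `F0P3cStCharTSUpTrAssemblyCore.upTransferLB_concrete_of_inputs` (p852534) takes the (A-2) input of the road BY SHAPE as its binder
`hP3 : ∀ g, IsRegularElt ↑g → ∑ᶠ_{q : stable classes of H_v} 𝟙[q.out G-regular ∧ q.out ↔ g] · τ(q.out) · dH(q.out) · κ(q.out, g) · α(q.out) = Σ_{T ∈ SH} cW T · Σ_{i : Fin (n T)} Σ_{x ∈ fib g T i} τ(x) · dH(x) · κ(x, g) · α(x)`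
(tree :162–:168, with ABSTRACT `dH : H_v → ℝ` and ABSTRACT weights `cW`).  FILE F (`upTransferLB_concrete` = ★ (P1) `F0P3cStCharTSUpTrDatumDict`'s `hconcrete` TYPE) specialises
`dH` to the CLOSED radical `s ↦ (NNReal.sqrt (NNReal.sqrt ((∏_w normAbs (charpoly ↑s.1).discr) · (∏_w normAbs (det ↑s.1))⁻¹)) : ℝ)` (DatumDict :113–:114) and `cW T` to ★ (P3)'s weight
`([N_H(T):T] : ℂ)⁻¹ · (m T : ℂ)⁻¹`.  This file is the discharge of `hP3` at those two specialisations, from MY LINEAGE's ★ (P3) `finsum_upSummand_eq_weightedSum` (one `exact` per `g`):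
* §1 `radicalH_eq_of_isLocalStablyConjH` — THE ONE NEW FACT: the closed `H`-radical is a STABLE CLASS FUNCTION on `H_v` (no regularity needed): stable conjugacy in
  `H_v = U(Φ₂) × U(Φ₁)` is componentwise (★ `IsLocalStablyConjH` = `IsStablyConjH`, conjugacy of `↑s.1` in `GL₂(E_v)`), so `charpoly ↑s.1` (★ `finCharpolyTwo_eq_of_isLocalStablyConjH`)
  and `det ↑s.1` (Mathlib `Matrix.det_units_conj`) are stable invariants — hence so is any expression in them [Rogawski1990 §3.1 p. 19; §4.9 p. 55: `D_H` depends on the stable class];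
* §2 `hP3_of_isStableClassFunOn` — E's `hP3` TYPE with `dH` kept ABSTRACT (E's letter) under (P3)'s `hDHst`, the `α`-stability taken in FILE F's own letter
  `Ch12Sec5.IsStableClassFunOn (IsLocalStablyConjH L v) {a | IsLocalGRegular L v a} α` (= the second antecedent of ★ (P1) `hconcrete`; its `.2` is ★ (P3)'s `hαst` token for token),
  the (H1) CARTAN-ALL-H letters `SH hZ hcomplete hirred` (= ★ `F0P3cStCharTSCartanAllH.exists_cartanAllH_classShape` clauses (2)(4)(5)), the (H6a′) TWIST-MAPS letters `m hclasses`
  BY SHAPE (the pen's ONE-`k` rule 19:42:54Z), and the (X2) letters `n ψ hψR hψuniq fib hfib` (= ★ `F0P3cStCharTSUpTrPsiOfEmb.exists_psi_of_embFamily` clauses (5)(6)(7), `fib`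
  indexed by `g` FIRST exactly as E binds it);
* §2 **`hP3_radicalH`** — THE (F3) HEAD: E's `hP3` TYPE at `dH :=` the closed radical and `cW T := ([N_H(T):T] : ℂ)⁻¹ * (m T : ℂ)⁻¹`, NO `hDHst` binder (§1 pays it), token for token
  what FILE F passes to E (up to the β-reduction of `cW T` and `dH s`).
E's `IsRegularElt ↑g` antecedent is carried but not used ((P3) holds at every `g`).  HONEST LABEL: count-neutral; block consequents 11 → 10 → 9 only at the rider editions; organs
2 = 2; h413 registry untouched; HC_CM is proved only modulo the 7 printed citations (2 remaining named inputs: hLiu418 = `stmt-HodgeConjecture-24832`, h413 =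
`stmt-HodgeConjecture-24833`) until rung 0 closes.

## References
* [Rogawski1990] J. D. Rogawski, *Automorphic Representations of Unitary Groups in Three Variables*, Ann. of Math. Stud. 123 (1990), §3.1 p. 19 (stable conjugacy),
  §4.9 p. 55 (`D_G`, `D_H`, `τ`, `κ`; the transfer `χ ↦ χ^G`), §12.5 pp. 182–183 (the count «`|Ω(T,G)|⁻¹|Ω_F(T,G)|`», the display defining `α ↦ α^G`, Lemma 12.5.1).
* [LanglandsShelstad1987] R. P. Langlands, D. Shelstad, *On the definition of transfer factors*, Math. Ann. 278 (1987), §1.3.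
-/

set_option autoImplicit false
-- the mandated namespace has the single-problem summit's repeated segment (`HodgeConjecture.HodgeConjecture`)
set_option linter.dupNamespace false

noncomputable section

open NumberField IsDedekindDomain Matrix
open scoped MatrixGroups NNReal Classical
open Literature.NumberTheory.Rogawski1990 Literature.NumberTheory.Automorphic Literature.NumberTheory.Automorphic.UnitaryGroup
open Literature.NumberTheory.GaloisRepresentations

namespace Summit.HodgeConjecture.HodgeConjecture.Cruxes.H413.F0P3cStCharTSUpTrClaimPRadical

variable (L : Type) [Field L] [NumberField L] [IsCMField L] (v : HeightOneSpectrum (𝓞 ↥(maximalRealSubfield L)))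

/-! ## §1 The closed Weyl radical of `H_v` is a stable class function -/

/-- **`D_H` IS A STABLE CLASS FUNCTION ON `H_v`.**  For `γ_H = (g, u) ∼_st γ_H' = (g', u')` in `H_v = U(Φ₂)(L⁺_v) × U(Φ₁)(L⁺_v)` (★ `IsLocalStablyConjH`: `g ∼ g'` in `GL₂(E_v)` and
`u = u'`), the closed radical `(∏_w |disc χ_{g}|_w · (∏_w |det g|_w)⁻¹)^{1∕4}` of ★ (P1) `hconcrete` takes the same value: `χ_{g'} = χ_g` (★ `finCharpolyTwo_eq_of_isLocalStablyConjH`)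
and `det g' = det g` (conjugate matrices). [cite: Rogawski1990, §3.1 p. 19; §4.9 p. 55] -/
theorem radicalH_eq_of_isLocalStablyConjH {a b : ((UnitaryGroup.cmDatum L 2 (Matrix.of fun i j : Fin 2 => if i.val + j.val + 1 = 2 then (1 : L) else 0)).Local v × (UnitaryGroup.cmDatum L 1 (Matrix.of fun i j : Fin 1 => if i.val + j.val + 1 = 1 then (1 : L) else 0)).Local v)}
    (h : IsLocalStablyConjH L v a b) :
    ((NNReal.sqrt (NNReal.sqrt ((∏ w : PlacesOver L v, IsNonarchimedeanLocalField.normAbs (w.1.adicCompletion L) (((b.1.val : GL (Fin 2) (UnitaryGroup.LocalRing L v)).val.charpoly.discr) w)) *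
              (∏ w : PlacesOver L v, IsNonarchimedeanLocalField.normAbs (w.1.adicCompletion L) (((b.1.val : GL (Fin 2) (UnitaryGroup.LocalRing L v)).val.det) w))⁻¹)) : ℝ≥0) : ℝ) =
      ((NNReal.sqrt (NNReal.sqrt ((∏ w : PlacesOver L v, IsNonarchimedeanLocalField.normAbs (w.1.adicCompletion L) (((a.1.val : GL (Fin 2) (UnitaryGroup.LocalRing L v)).val.charpoly.discr) w)) *
              (∏ w : PlacesOver L v, IsNonarchimedeanLocalField.normAbs (w.1.adicCompletion L) (((a.1.val : GL (Fin 2) (UnitaryGroup.LocalRing L v)).val.det) w))⁻¹)) : ℝ≥0) : ℝ) := by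
  have hχ : ((b.1.val : GL (Fin 2) (UnitaryGroup.LocalRing L v)).val.charpoly) = ((a.1.val : GL (Fin 2) (UnitaryGroup.LocalRing L v)).val.charpoly) :=
    finCharpolyTwo_eq_of_isLocalStablyConjH L v h
  have hd : ((b.1.val : GL (Fin 2) (UnitaryGroup.LocalRing L v)).val.det) = ((a.1.val : GL (Fin 2) (UnitaryGroup.LocalRing L v)).val.det) := by
    obtain ⟨c, hc⟩ := isConj_iff.1 h.1
    rw [← hc, Units.val_mul, Units.val_mul, Matrix.det_units_conj]
  rw [hχ, hd]

/-- The `G`-regular-guarded form of §1 in ★ (P3)'s `hDHst` letter: `IsLocalGRegular a → a ∼_st b → D_H b = D_H a`. [cite: Rogawski1990, §4.9 p. 55] -/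
theorem radicalH_eq_of_isLocalGRegular_of_isLocalStablyConjH :
    ∀ a b : ((UnitaryGroup.cmDatum L 2 (Matrix.of fun i j : Fin 2 => if i.val + j.val + 1 = 2 then (1 : L) else 0)).Local v × (UnitaryGroup.cmDatum L 1 (Matrix.of fun i j : Fin 1 => if i.val + j.val + 1 = 1 then (1 : L) else 0)).Local v),
      IsLocalGRegular L v a → IsLocalStablyConjH L v a b →
      ((NNReal.sqrt (NNReal.sqrt ((∏ w : PlacesOver L v, IsNonarchimedeanLocalField.normAbs (w.1.adicCompletion L) (((b.1.val : GL (Fin 2) (UnitaryGroup.LocalRing L v)).val.charpoly.discr) w)) *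
              (∏ w : PlacesOver L v, IsNonarchimedeanLocalField.normAbs (w.1.adicCompletion L) (((b.1.val : GL (Fin 2) (UnitaryGroup.LocalRing L v)).val.det) w))⁻¹)) : ℝ≥0) : ℝ) =
        ((NNReal.sqrt (NNReal.sqrt ((∏ w : PlacesOver L v, IsNonarchimedeanLocalField.normAbs (w.1.adicCompletion L) (((a.1.val : GL (Fin 2) (UnitaryGroup.LocalRing L v)).val.charpoly.discr) w)) *
              (∏ w : PlacesOver L v, IsNonarchimedeanLocalField.normAbs (w.1.adicCompletion L) (((a.1.val : GL (Fin 2) (UnitaryGroup.LocalRing L v)).val.det) w))⁻¹)) : ℝ≥0) : ℝ) :=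
  fun _ _ _ h => radicalH_eq_of_isLocalStablyConjH L v h

/-! ## §2 E's `hP3` binder discharged: abstract `dH` under `hDHst`, and the closed radical with no stability binder -/

section Heads

variable (hns : ∀ w : PlacesOver L v, IsCMField.complexConj L • w.1 = w.1) (μ : HeckeCharacter L)
  -- the stable class function `α` in FILE F's letter (the second antecedent of ★ (P1) `hconcrete`)
  (α : ((UnitaryGroup.cmDatum L 2 (Matrix.of fun i j : Fin 2 => if i.val + j.val + 1 = 2 then (1 : L) else 0)).Local v × (UnitaryGroup.cmDatum L 1 (Matrix.of fun i j : Fin 1 => if i.val + j.val + 1 = 1 then (1 : L) else 0)).Local v) → ℂ)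
  (hαst : Ch12Sec5.IsStableClassFunOn (IsLocalStablyConjH L v) {a : ((UnitaryGroup.cmDatum L 2 (Matrix.of fun i j : Fin 2 => if i.val + j.val + 1 = 2 then (1 : L) else 0)).Local v × (UnitaryGroup.cmDatum L 1 (Matrix.of fun i j : Fin 1 => if i.val + j.val + 1 = 1 then (1 : L) else 0)).Local v) | IsLocalGRegular L v a} α)
  -- (H1) CARTAN-ALL-H letters = ★ `exists_cartanAllH_classShape` clauses (2)(4)(5)
    (SH : Finset (Subgroup ((UnitaryGroup.cmDatum L 2 (Matrix.of fun i j : Fin 2 => if i.val + j.val + 1 = 2 then (1 : L) else 0)).Local v × (UnitaryGroup.cmDatum L 1 (Matrix.of fun i j : Fin 1 => if i.val + j.val + 1 = 1 then (1 : L) else 0)).Local v)))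
    (hZ : ∀ T ∈ SH, ∃ γ₀ : ((UnitaryGroup.cmDatum L 2 (Matrix.of fun i j : Fin 2 => if i.val + j.val + 1 = 2 then (1 : L) else 0)).Local v × (UnitaryGroup.cmDatum L 1 (Matrix.of fun i j : Fin 1 => if i.val + j.val + 1 = 1 then (1 : L) else 0)).Local v),
      IsLocalGRegular L v γ₀ ∧ T = Subgroup.centralizer ({γ₀} : Set ((UnitaryGroup.cmDatum L 2 (Matrix.of fun i j : Fin 2 => if i.val + j.val + 1 = 2 then (1 : L) else 0)).Local v × (UnitaryGroup.cmDatum L 1 (Matrix.of fun i j : Fin 1 => if i.val + j.val + 1 = 1 then (1 : L) else 0)).Local v)))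
    (hcomplete : ∀ h : ((UnitaryGroup.cmDatum L 2 (Matrix.of fun i j : Fin 2 => if i.val + j.val + 1 = 2 then (1 : L) else 0)).Local v × (UnitaryGroup.cmDatum L 1 (Matrix.of fun i j : Fin 1 => if i.val + j.val + 1 = 1 then (1 : L) else 0)).Local v), IsLocalGRegular L v h → ∃ T ∈ SH, ∃ s ∈ T, IsConj h s)
    (hirred : ∀ T ∈ SH, ∀ T' ∈ SH, ∀ s ∈ T, ∀ s' ∈ T', IsLocalGRegular L v s → IsConj s s' → T = T')
    -- (H6a′) TWIST-MAPS letters, BY SHAPE (the pen's ONE-`k` rule: `m` stays a binder)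
    (m : Subgroup ((UnitaryGroup.cmDatum L 2 (Matrix.of fun i j : Fin 2 => if i.val + j.val + 1 = 2 then (1 : L) else 0)).Local v × (UnitaryGroup.cmDatum L 1 (Matrix.of fun i j : Fin 1 => if i.val + j.val + 1 = 1 then (1 : L) else 0)).Local v) → ℕ)
    (hclasses : ∀ T ∈ SH, ∀ s ∈ T, IsLocalGRegular L v s →
      ∃ C : Finset ((UnitaryGroup.cmDatum L 2 (Matrix.of fun i j : Fin 2 => if i.val + j.val + 1 = 2 then (1 : L) else 0)).Local v × (UnitaryGroup.cmDatum L 1 (Matrix.of fun i j : Fin 1 => if i.val + j.val + 1 = 1 then (1 : L) else 0)).Local v),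
        (∀ x ∈ C, IsLocalStablyConjH L v s x) ∧ (∀ x ∈ C, ∀ y ∈ C, IsConj x y → x = y) ∧ (∀ y, IsLocalStablyConjH L v s y → ∃ x ∈ C, IsConj y x) ∧ C.card = m T)
    -- (X2) «ψ FROM e» letters = ★ `exists_psi_of_embFamily` clauses (5)(6)(7), `fib` indexed by `g` FIRST as in ★ E
    (n : Subgroup ((UnitaryGroup.cmDatum L 2 (Matrix.of fun i j : Fin 2 => if i.val + j.val + 1 = 2 then (1 : L) else 0)).Local v × (UnitaryGroup.cmDatum L 1 (Matrix.of fun i j : Fin 1 => if i.val + j.val + 1 = 1 then (1 : L) else 0)).Local v) → ℕ)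
    (ψ : (T : Subgroup ((UnitaryGroup.cmDatum L 2 (Matrix.of fun i j : Fin 2 => if i.val + j.val + 1 = 2 then (1 : L) else 0)).Local v × (UnitaryGroup.cmDatum L 1 (Matrix.of fun i j : Fin 1 => if i.val + j.val + 1 = 1 then (1 : L) else 0)).Local v)) → Fin (n T) → ((UnitaryGroup.cmDatum L 2 (Matrix.of fun i j : Fin 2 => if i.val + j.val + 1 = 2 then (1 : L) else 0)).Local v × (UnitaryGroup.cmDatum L 1 (Matrix.of fun i j : Fin 1 => if i.val + j.val + 1 = 1 then (1 : L) else 0)).Local v) → Gqs L v)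
    (hψR : ∀ T ∈ SH, ∀ (i : Fin (n T)), ∀ s ∈ T, IsLocalGRegular L v s → IsLocalNormPair L (qsForm L) v s (ψ T i s))
    (hψuniq : ∀ T ∈ SH, ∀ s ∈ T, IsLocalGRegular L v s → ∀ g : Gqs L v, IsLocalNormPair L (qsForm L) v s g → ∃! i : Fin (n T), IsConj (ψ T i s) g)
    (fib : Gqs L v → (T : Subgroup ((UnitaryGroup.cmDatum L 2 (Matrix.of fun i j : Fin 2 => if i.val + j.val + 1 = 2 then (1 : L) else 0)).Local v × (UnitaryGroup.cmDatum L 1 (Matrix.of fun i j : Fin 1 => if i.val + j.val + 1 = 1 then (1 : L) else 0)).Local v)) → Fin (n T) → Finset ((UnitaryGroup.cmDatum L 2 (Matrix.of fun i j : Fin 2 => if i.val + j.val + 1 = 2 then (1 : L) else 0)).Local v × (UnitaryGroup.cmDatum L 1 (Matrix.of fun i j : Fin 1 => if i.val + j.val + 1 = 1 then (1 : L) else 0)).Local v))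
    (hfib : ∀ g : Gqs L v, ∀ T ∈ SH, ∀ (i : Fin (n T)), ∀ x, x ∈ fib g T i ↔ x ∈ T ∧ IsLocalGRegular L v x ∧ IsConj (ψ T i x) g)

include hns hαst hZ hcomplete hirred hclasses hψR hψuniq hfib in
/-- **E's `hP3` with `dH` ABSTRACT** (E's own letter `dH : H_v → ℝ`, under ★ (P3)'s `hDHst`): for every (regular) `g ∈ U(Φ₃)(L⁺_v)`,
`∑ᶠ_{q} 𝟙[q.out G-regular ∧ q.out ↔ g] · τ · dH · κ(·, g) · α (q.out) = Σ_{T ∈ SH} ([N_H(T):T] : ℂ)⁻¹ · (m T : ℂ)⁻¹ · Σ_i Σ_{x ∈ fib g T i} τ(x) · dH(x) · κ(x, g) · α(x)` — ★ (P3)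
`finsum_upSummand_eq_weightedSum` at `fib := fib g`, the `α`-stability read off `hαst.2`. [cite: Rogawski1990, §12.5 pp. 182–183, Lemma 12.5.1] [cite: LanglandsShelstad1987, §1.3] -/
theorem hP3_of_isStableClassFunOn
    (dH : ((UnitaryGroup.cmDatum L 2 (Matrix.of fun i j : Fin 2 => if i.val + j.val + 1 = 2 then (1 : L) else 0)).Local v × (UnitaryGroup.cmDatum L 1 (Matrix.of fun i j : Fin 1 => if i.val + j.val + 1 = 1 then (1 : L) else 0)).Local v) → ℝ)
    (hDHst : ∀ a b, IsLocalGRegular L v a → IsLocalStablyConjH L v a b → dH b = dH a) :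
    ∀ g : Gqs L v, IsRegularElt (g.val : GL (Fin 3) (UnitaryGroup.LocalRing L v)) →
      (∑ᶠ q : Quot (IsLocalStablyConjH L v),
              (if IsLocalGRegular L v q.out ∧ IsLocalNormPair L (qsForm L) v q.out g then
                finTau L v q.out μ * (dH q.out : ℂ) * ((finKappaAt L v (qsForm L) q.out g : ℤ) : ℂ) * α q.out
              else 0)) =
        ∑ T ∈ SH, (((T.subgroupOf (Subgroup.normalizer (T : Set ((UnitaryGroup.cmDatum L 2 (Matrix.of fun i j : Fin 2 => if i.val + j.val + 1 = 2 then (1 : L) else 0)).Local v × (UnitaryGroup.cmDatum L 1 (Matrix.of fun i j : Fin 1 => if i.val + j.val + 1 = 1 then (1 : L) else 0)).Local v)))).index : ℂ)⁻¹ * ((m T : ℂ))⁻¹) * ∑ i : Fin (n T), ∑ x ∈ fib g T i, finTau L v x μ * (dH x : ℂ) * ((finKappaAt L v (qsForm L) x g : ℤ) : ℂ) * α x := by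
  intro g _
  exact F0P3cStCharTSUpTrClaimP.finsum_upSummand_eq_weightedSum L v hns μ dH hDHst α (fun a b ha hab => hαst.2 a ha b hab)
    SH hZ hcomplete hirred m n ψ hclasses hψR hψuniq g (fib g) (hfib g)

include hns hαst hZ hcomplete hirred hclasses hψR hψuniq hfib in
/-- **(F3) «hP3 OF (P3)» — E's `hP3` binder at the CLOSED radical `D_H` and (P3)'s weights, no stability binder.**  For every (regular) `g ∈ U(Φ₃)(L⁺_v)` (`v` non-split):
`∑ᶠ_{q : stable classes of H_v} 𝟙[q.out G-regular ∧ q.out ↔ g] · τ(q.out) · D_H(q.out) · κ(q.out, g) · α(q.out) = Σ_{T ∈ SH} ([N_H(T):T] : ℂ)⁻¹ · (m T : ℂ)⁻¹ · Σ_{i : Fin (n T)} Σ_{x ∈ fib g T i} τ(x) · D_H(x) · κ(x, g) · α(x)`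
with `D_H(s) = (∏_w |disc χ_{s.1}|_w · (∏_w |det s.1|_w)⁻¹)^{1∕4}` spelled as in ★ (P1) `hconcrete` — §1 pays `hDHst`, ★ (P3) does the rest; this is the term FILE F hands to ★ E's `hP3`
(`cW T := ([N_H(T):T] : ℂ)⁻¹ * (m T : ℂ)⁻¹`, `dH :=` the radical, up to β). [cite: Rogawski1990, §12.5 pp. 182–183, Lemma 12.5.1; §4.9 p. 55] [cite: LanglandsShelstad1987, §1.3] -/
theorem hP3_radicalH :
    ∀ g : Gqs L v, IsRegularElt (g.val : GL (Fin 3) (UnitaryGroup.LocalRing L v)) →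
      (∑ᶠ q : Quot (IsLocalStablyConjH L v),
              (if IsLocalGRegular L v q.out ∧ IsLocalNormPair L (qsForm L) v q.out g then
                finTau L v q.out μ * (((NNReal.sqrt (NNReal.sqrt ((∏ w : PlacesOver L v, IsNonarchimedeanLocalField.normAbs (w.1.adicCompletion L) (((q.out.1.val : GL (Fin 2) (UnitaryGroup.LocalRing L v)).val.charpoly.discr) w)) *
              (∏ w : PlacesOver L v, IsNonarchimedeanLocalField.normAbs (w.1.adicCompletion L) (((q.out.1.val : GL (Fin 2) (UnitaryGroup.LocalRing L v)).val.det) w))⁻¹)) : ℝ≥0) : ℝ) : ℂ) * ((finKappaAt L v (qsForm L) q.out g : ℤ) : ℂ) * α q.out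
              else 0)) =
        ∑ T ∈ SH, (((T.subgroupOf (Subgroup.normalizer (T : Set ((UnitaryGroup.cmDatum L 2 (Matrix.of fun i j : Fin 2 => if i.val + j.val + 1 = 2 then (1 : L) else 0)).Local v × (UnitaryGroup.cmDatum L 1 (Matrix.of fun i j : Fin 1 => if i.val + j.val + 1 = 1 then (1 : L) else 0)).Local v)))).index : ℂ)⁻¹ * ((m T : ℂ))⁻¹) * ∑ i : Fin (n T), ∑ x ∈ fib g T i, finTau L v x μ * (((NNReal.sqrt (NNReal.sqrt ((∏ w : PlacesOver L v, IsNonarchimedeanLocalField.normAbs (w.1.adicCompletion L) (((x.1.val : GL (Fin 2) (UnitaryGroup.LocalRing L v)).val.charpoly.discr) w)) *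
              (∏ w : PlacesOver L v, IsNonarchimedeanLocalField.normAbs (w.1.adicCompletion L) (((x.1.val : GL (Fin 2) (UnitaryGroup.LocalRing L v)).val.det) w))⁻¹)) : ℝ≥0) : ℝ) : ℂ) * ((finKappaAt L v (qsForm L) x g : ℤ) : ℂ) * α x :=
  hP3_of_isStableClassFunOn L v hns μ α hαst SH hZ hcomplete hirred m hclasses n ψ hψR hψuniq fib hfib
    (fun s => ((NNReal.sqrt (NNReal.sqrt ((∏ w : PlacesOver L v, IsNonarchimedeanLocalField.normAbs (w.1.adicCompletion L) (((s.1.val : GL (Fin 2) (UnitaryGroup.LocalRing L v)).val.charpoly.discr) w)) *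
              (∏ w : PlacesOver L v, IsNonarchimedeanLocalField.normAbs (w.1.adicCompletion L) (((s.1.val : GL (Fin 2) (UnitaryGroup.LocalRing L v)).val.det) w))⁻¹)) : ℝ≥0) : ℝ))
    (radicalH_eq_of_isLocalGRegular_of_isLocalStablyConjH L v)

end Heads

end Summit.HodgeConjecture.HodgeConjecture.Cruxes.H413.F0P3cStCharTSUpTrClaimPRadical

end
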